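import Mathlib.LinearAlgebra.Eigenspace.Basic
import Mathlib.LinearAlgebra.ExteriorPower.Basic
import Mathlib.Tactic.Module
import Literature.AlgebraicGeometry.Motives.AbelianVariety
import Literature.AlgebraicGeometry.Motives.AbelianVarietyProjectiveChart
import Literature.AlgebraicGeometry.Motives.AbelianVarietyTorsionCubeProofs
import Literature.AlgebraicGeometry.HodgeTheory.GysinFormalism
import Literature.AlgebraicGeometry.HodgeTheory.HodgeConjectureQbarVoisinProofs
import Literature.AlgebraicTopology.SingularHomology.CupProductExteriorH1
import Literature.NumberTheory.DiophantineGeometry.AVIsogenyFlat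
import HarnessLib

/-!
# Crux `HyperbolicEightfoldsSqrtMinus7` (stmt-HodgeConjecture-14642), line `Sketch`
# (idea `dicyclic-quaternion-switch`) · Stub 2 `stub_switchTransfer`

Route `HeckePrymWeil`.  The quaternion FIELD SWITCH on the real carriers: for a complex abelian
eightfold `A` with endomorphisms `φ ≫ φ = -7`, `ψ ≫ ψ = -3m²` (`m ≥ 1`), `φ ≫ ψ + ψ ≫ φ = t·𝟙`,
`t² < 84m²`, if every class of the typed `ψ`-plane
`Eig((2m·𝟙+ψ)^*, m⁸(2+i√3)⁸) ⊔ Eig((2m·𝟙+ψ)^*, m⁸(2-i√3)⁸) ⊆ H⁸(A(ℂ); ℂ)` is algebraic, then so is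
every class of the typed `φ`-plane `Eig((𝟙+φ)^*, (1+i√7)⁸) ⊔ Eig((𝟙+φ)^*, (1-i√7)⁸)` — GIVEN, as
explicit hypotheses, (i) the abstract switch in `⋀⁸V` (`dim V = 16`; the line's Stub 1, pure linear
algebra), (ii) `H•(A(ℂ); ℂ) = ⋀•H¹` via the cup product with `dim H¹ = 2 dim A` (Stub 3;
Birkenhake–Lange 1.1.17–1.1.19, Hatcher 3.16) and (iii) additivity `(f + g)^* = f^* + g^*` of
pull-back on `H¹` (Stub 4; Birkenhake–Lange §1.2).

## Proof (transfer along `H⁸ = ⋀⁸H¹`)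

* `V := H¹(A(ℂ); ℂ)`, `F := φ^*|_V`, `G := ψ^*|_V`.  Additivity (iii) makes `u ↦ u^*|_V` an additive
  map `End(A) →+ End(V)`, so `(n • u)^* = n · u^*` and `(-u)^* = -u^*` on `V`; with functoriality
  (`complexBetti.map_comp`, contravariant — harmless since all relations are symmetric) this gives
  `F² = -7`, `G² = -3m²`, `FG + GF = t`, `(𝟙+φ)^*|_V = 1 + F`, `(k·𝟙+φ)^*|_V = k + F`,
  `(2m·𝟙+ψ)^*|_V = 2m + G`.
* Naturality `u^* ∘ wedgeToCup = wedgeToCup ∘ ⋀⁸(u^*|_V)` (`map_comp_wedgeToCup`, PROVED in the tree)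
  and bijectivity of `wedgeToCup` (ii) identify `Eig(u^*|_{H⁸}, μ)` with
  `wedgeToCup (Eig(⋀⁸(u^*|_V), μ))` and `u^*(wedgeToCup P)` with `wedgeToCup (⋀⁸(u^*|_V) P)`
  (`map_eigenspace_eq_of_comm_of_bijective`).
* Stub 1 puts the abstract `(1+F)`-plane inside `Σ_{k<9} ⋀⁸(k+F) (abstract (2m+G)-plane)`; applying
  `wedgeToCup`, the typed `φ`-plane lies in `Σ_k (k·𝟙+φ)^* (typed ψ-plane)`.
* `u_k := k·𝟙 + φ` is an isogeny: `u_k ≫ (k·𝟙 - φ) = (k·𝟙 - φ) ≫ u_k = (k²+7)·𝟙` and `(k²+7)·𝟙` is an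
  isogeny (`isIsogeny_zsmul_id_holds`), so `u_k` is surjective and finite (Mathlib
  `Surjective.of_comp`, `IsFinite.of_comp`); hence flat (`IsIsogeny.flat`), and flat pull-back
  preserves `algebraicClasses` (`map_mem_algebraicClasses_of_flat`; abelian varieties are locally
  Noetherian, `AbelianVariety.isSmoothProjective_holds`).  The typed `ψ`-plane being algebraic by
  hypothesis, so is each `u_k^*` of it, and `algebraicClasses A.X 4` is a `ℂ`-submodule.

No named fact is introduced; the three infrastructure statements enter only as the hypotheses of the
registered signature.
-/

noncomputable section
-- every declaration of this problem lives in Summit.HodgeConjecture.HodgeConjecture.… (summit = sub-problem)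
set_option linter.dupNamespace false

open CategoryTheory AlgebraicGeometry
open Literature.AlgebraicGeometry Literature.AlgebraicGeometry.Motives
  Literature.AlgebraicGeometry.HodgeTheory Literature.AlgebraicTopology.SingularHomology

namespace Summit.HodgeConjecture.HodgeConjecture.Theorems.HyperbolicEightfoldsSqrtMinus7.DicyclicQuaternionSwitch

/-! ### Linear algebra: eigenspaces and images under an intertwining bijection -/

/-- Conjugating eigenspaces: if `w : M → N` is a linear bijection intertwining `S ∈ End M` and
`T ∈ End N` (`T ∘ w = w ∘ S`), then `w (Eig(S, μ)) = Eig(T, μ)`. [folklore] -/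
theorem map_eigenspace_eq_of_comm_of_bijective {R M N : Type*} [CommRing R] [AddCommGroup M]
    [Module R M] [AddCommGroup N] [Module R N] (w : M →ₗ[R] N) (hw : Function.Bijective w)
    (S : Module.End R M) (T : Module.End R N) (h : T ∘ₗ w = w ∘ₗ S) (μ : R) :
    Submodule.map w (Module.End.eigenspace S μ) = Module.End.eigenspace T μ := by
  have hx : ∀ x, T (w x) = w (S x) := fun x => LinearMap.congr_fun h x
  refine le_antisymm (Submodule.map_le_iff_le_comap.2 fun x hxS => ?_) fun c hc => ?_
  · rw [Submodule.mem_comap, Module.End.mem_eigenspace_iff, hx,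
      Module.End.mem_eigenspace_iff.1 hxS, map_smul]
  · obtain ⟨x, rfl⟩ := hw.2 c
    refine Submodule.mem_map_of_mem ?_
    rw [Module.End.mem_eigenspace_iff] at hc ⊢
    apply hw.1
    rw [← hx, hc, map_smul]

/-- If `w (P i) ≤ Q` for every `i`, then `w x ∈ Q` for every `x ∈ ⨆ i, P i` (`w` linear).
[folklore] -/
theorem map_mem_of_mem_iSup {R M N : Type*} [CommRing R] [AddCommGroup M] [Module R M]
    [AddCommGroup N] [Module R N] {ι : Type*} (w : M →ₗ[R] N) {P : ι → Submodule R M}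
    {Q : Submodule R N} {x : M} (hx : x ∈ ⨆ i, P i) (h : ∀ i, Submodule.map w (P i) ≤ Q) :
    w x ∈ Q := by
  have hwx : w x ∈ Submodule.map w (⨆ i, P i) := Submodule.mem_map_of_mem hx
  rw [Submodule.map_iSup] at hwx
  exact iSup_le h hwx

/-! ### Pull-back along endomorphisms of a complex abelian variety on `Hᵏ(A(ℂ); ℂ)` -/

variable {A : AbelianVariety ℂ}

/-- Functoriality: `(f ≫ g)^* = f^* ∘ g^*` on `Hᵏ(A(ℂ); ℂ)` (as linear maps; the tree's
`complexBetti.map_comp`). [folklore] -/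
theorem hom_map_comp (f g : A ⟶ A) (k : ℕ) :
    (complexBetti.map (f ≫ g).hom.hom.hom k).hom =
      (complexBetti.map f.hom.hom.hom k).hom ∘ₗ (complexBetti.map g.hom.hom.hom k).hom := by
  change (complexBetti.map (f.hom.hom.hom ≫ g.hom.hom.hom) k).hom = _
  rw [complexBetti.map_comp, ModuleCat.hom_comp]

/-- `(𝟙 A)^* = id` on `Hᵏ(A(ℂ); ℂ)` (the tree's `complexBetti.map_id`). [folklore] -/
theorem hom_map_id (k : ℕ) :
    (complexBetti.map (𝟙 A : A ⟶ A).hom.hom.hom k).hom = LinearMap.id := by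
  change (complexBetti.map (𝟙 A.X) k).hom = _
  rw [complexBetti.map_id, ModuleCat.hom_id]

/-- Additivity of pull-back on `H¹` packages `u ↦ u^*|_{H¹}` as an additive map
`End(A) →+ End(H¹(A(ℂ); ℂ))` (Birkenhake–Lange §1.2: the rational representation is additive).
[cite: LangeBirkenhake1992, §1.2] -/
theorem exists_addMonoidHom_map_one
    (hAdd : ∀ (f g : A ⟶ A) (v : complexBetti A.X 1),
      complexBetti.map (f + g).hom.hom.hom 1 v =
        complexBetti.map f.hom.hom.hom 1 v + complexBetti.map g.hom.hom.hom 1 v) :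
    ∃ Φ : (A ⟶ A) →+ Module.End ℂ (complexBetti A.X 1),
      ∀ f : A ⟶ A, Φ f = (complexBetti.map f.hom.hom.hom 1).hom :=
  ⟨AddMonoidHom.mk' (fun g => (complexBetti.map g.hom.hom.hom 1).hom)
      fun g g' => LinearMap.ext fun v => hAdd g g' v,
    fun _ => rfl⟩

/-- `(f + g)^* = f^* + g^*` on `H¹(A(ℂ); ℂ)`, linear-map form. [cite: LangeBirkenhake1992, §1.2] -/
theorem hom_map_one_add
    (hAdd : ∀ (f g : A ⟶ A) (v : complexBetti A.X 1),
      complexBetti.map (f + g).hom.hom.hom 1 v =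
        complexBetti.map f.hom.hom.hom 1 v + complexBetti.map g.hom.hom.hom 1 v)
    (f g : A ⟶ A) :
    (complexBetti.map (f + g).hom.hom.hom 1).hom =
      (complexBetti.map f.hom.hom.hom 1).hom + (complexBetti.map g.hom.hom.hom 1).hom :=
  LinearMap.ext fun v => hAdd f g v

/-- `(n • f)^* = n · f^*` on `H¹(A(ℂ); ℂ)` for `n : ℤ`. [cite: LangeBirkenhake1992, §1.2] -/
theorem hom_map_one_zsmul
    (hAdd : ∀ (f g : A ⟶ A) (v : complexBetti A.X 1),
      complexBetti.map (f + g).hom.hom.hom 1 v =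
        complexBetti.map f.hom.hom.hom 1 v + complexBetti.map g.hom.hom.hom 1 v)
    (n : ℤ) (f : A ⟶ A) :
    (complexBetti.map (n • f).hom.hom.hom 1).hom = (n : ℂ) • (complexBetti.map f.hom.hom.hom 1).hom := by
  obtain ⟨Φ, hΦ⟩ := exists_addMonoidHom_map_one hAdd
  rw [← hΦ, ← hΦ, map_zsmul, Int.cast_smul_eq_zsmul]

/-- `(-f)^* = -f^*` on `H¹(A(ℂ); ℂ)`. [cite: LangeBirkenhake1992, §1.2] -/
theorem hom_map_one_neg
    (hAdd : ∀ (f g : A ⟶ A) (v : complexBetti A.X 1),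
      complexBetti.map (f + g).hom.hom.hom 1 v =
        complexBetti.map f.hom.hom.hom 1 v + complexBetti.map g.hom.hom.hom 1 v)
    (f : A ⟶ A) :
    (complexBetti.map (-f).hom.hom.hom 1).hom = -(complexBetti.map f.hom.hom.hom 1).hom := by
  obtain ⟨Φ, hΦ⟩ := exists_addMonoidHom_map_one hAdd
  rw [← hΦ, ← hΦ, map_neg]

/-- `(n • 𝟙 A)^* = n` on `H¹(A(ℂ); ℂ)` for `n : ℤ`. [cite: LangeBirkenhake1992, §1.2] -/
theorem hom_map_one_zsmul_id
    (hAdd : ∀ (f g : A ⟶ A) (v : complexBetti A.X 1),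
      complexBetti.map (f + g).hom.hom.hom 1 v =
        complexBetti.map f.hom.hom.hom 1 v + complexBetti.map g.hom.hom.hom 1 v)
    (n : ℤ) :
    (complexBetti.map (n • 𝟙 A).hom.hom.hom 1).hom = (n : ℂ) • LinearMap.id := by
  rw [hom_map_one_zsmul hAdd, hom_map_id]

/-! ### Transfer along `H^d = ⋀^d H¹` -/

/-- For an endomorphism `u` with `u^*|_{H¹} = S`: the comparison map `wedgeToCup` carries
`Eig(⋀ᵈ S, μ)` onto `Eig(u^*|_{Hᵈ}, μ)` when `H• = ⋀•H¹` (naturality `map_comp_wedgeToCup` +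
bijectivity). [cite: Hatcher2002, Prop. 3.10] -/
theorem map_wedgeToCup_eigenspace (hE : HasExteriorCohomologyH1 ℂ (ComplexPoints A.X)) (d : ℕ)
    (u : A ⟶ A) {S : Module.End ℂ (complexBetti A.X 1)}
    (hS : (complexBetti.map u.hom.hom.hom 1).hom = S) (μ : ℂ) :
    Submodule.map (wedgeToCup ℂ (ComplexPoints A.X) d) (Module.End.eigenspace (exteriorPower.map d S) μ) =
      Module.End.eigenspace (complexBetti.map u.hom.hom.hom d).hom μ := by
  subst hS
  exact map_eigenspace_eq_of_comm_of_bijective _ (hE d) _ _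
    (map_comp_wedgeToCup (R := ℂ) (Motives.AlgPoints.mapContinuous (L := ℂ) u.hom.hom.hom) d) μ

/-- For an endomorphism `u` with `u^*|_{H¹} = S` and any `P ⊆ ⋀ᵈ H¹`:
`wedgeToCup (⋀ᵈ S · P) = u^* (wedgeToCup P)` (naturality `map_comp_wedgeToCup`).
[cite: Hatcher2002, Prop. 3.10] -/
theorem map_wedgeToCup_map (d : ℕ) (u : A ⟶ A) {S : Module.End ℂ (complexBetti A.X 1)}
    (hS : (complexBetti.map u.hom.hom.hom 1).hom = S)
    (P : Submodule ℂ (⋀[ℂ]^d (complexBetti A.X 1))) :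
    Submodule.map (wedgeToCup ℂ (ComplexPoints A.X) d) (Submodule.map (exteriorPower.map d S) P) =
      Submodule.map (complexBetti.map u.hom.hom.hom d).hom
        (Submodule.map (wedgeToCup ℂ (ComplexPoints A.X) d) P) := by
  subst hS
  rw [← Submodule.map_comp, ← Submodule.map_comp,
    ← map_comp_wedgeToCup (R := ℂ) (Motives.AlgPoints.mapContinuous (L := ℂ) u.hom.hom.hom) d]

/-! ### `k·𝟙 + φ` is an isogeny, hence its pull-back preserves algebraic classes -/

/-- If `u ≫ u' = N·𝟙` and `u' ≫ u = N·𝟙` with `N ≠ 0` then `u` is an isogeny: surjective because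
`u' ≫ u = [N]` is (Mathlib `Surjective.of_comp`), finite because `u ≫ u' = [N]` is while `u'` is
separated (Mathlib `IsFinite.of_comp`); `[N]` is an isogeny by `isIsogeny_zsmul_id_holds`
(Görtz–Wedhorn II, Prop. 27.186; Mumford §19, Remark p. 169). [cite: GortzWedhorn2023, Prop. 27.186] -/
theorem isIsogeny_of_comp_eq_zsmul_id {u u' : A ⟶ A} {N : ℤ} (hN : N ≠ 0)
    (h₁ : u ≫ u' = N • 𝟙 A) (h₂ : u' ≫ u = N • 𝟙 A) : AbelianVariety.IsIsogeny u := by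
  obtain ⟨hs, hf⟩ := AbelianVariety.isIsogeny_zsmul_id_holds A N hN
  constructor
  · have : Surjective (AbelianVariety.Hom.toSchemeHom u' ≫ AbelianVariety.Hom.toSchemeHom u) := by
      rw [← AbelianVariety.toSchemeHom_comp, h₂]
      exact hs
    exact Surjective.of_comp (AbelianVariety.Hom.toSchemeHom u') (AbelianVariety.Hom.toSchemeHom u)
  · have : IsFinite (AbelianVariety.Hom.toSchemeHom u ≫ AbelianVariety.Hom.toSchemeHom u') := by
      rw [← AbelianVariety.toSchemeHom_comp, h₁]
      exact hf
    have : IsSeparated (AbelianVariety.Hom.toSchemeHom u') := by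
      have : IsSeparated (AbelianVariety.Hom.toSchemeHom u' ≫ A.X.hom) := by
        rw [Over.w u'.hom.hom.hom]
        infer_instance
      exact IsSeparated.of_comp (AbelianVariety.Hom.toSchemeHom u') A.X.hom
    exact IsFinite.of_comp (AbelianVariety.Hom.toSchemeHom u) (AbelianVariety.Hom.toSchemeHom u')

/-- `(k·𝟙 + φ) ≫ (k·𝟙 - φ) = (k² + 7)·𝟙` for `φ ≫ φ = -7` (composition is bilinear). [folklore] -/
theorem zsmul_id_add_comp_zsmul_id_sub {φ : A ⟶ A} (hφ : φ ≫ φ = -((7 : ℤ) • 𝟙 A)) (k : ℤ) :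
    (k • 𝟙 A + φ) ≫ (k • 𝟙 A - φ) = (k ^ 2 + 7) • 𝟙 A := by
  simp only [Preadditive.add_comp, Preadditive.comp_sub, Preadditive.zsmul_comp,
    Preadditive.comp_zsmul, Category.id_comp, Category.comp_id, hφ]
  module

/-- `(k·𝟙 - φ) ≫ (k·𝟙 + φ) = (k² + 7)·𝟙` for `φ ≫ φ = -7`. [folklore] -/
theorem zsmul_id_sub_comp_zsmul_id_add {φ : A ⟶ A} (hφ : φ ≫ φ = -((7 : ℤ) • 𝟙 A)) (k : ℤ) :
    (k • 𝟙 A - φ) ≫ (k • 𝟙 A + φ) = (k ^ 2 + 7) • 𝟙 A := by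
  simp only [Preadditive.sub_comp, Preadditive.comp_add, Preadditive.zsmul_comp,
    Preadditive.comp_zsmul, Category.id_comp, Category.comp_id, hφ]
  module

/-- **`k·𝟙 + φ` is an isogeny** for `φ ≫ φ = -7` and `k : ℤ` (`(k·𝟙+φ)(k·𝟙-φ) = (k²+7)·𝟙`,
`k² + 7 ≠ 0`). [cite: GortzWedhorn2023, Prop. 27.186] -/
theorem isIsogeny_zsmul_id_add {φ : A ⟶ A} (hφ : φ ≫ φ = -((7 : ℤ) • 𝟙 A)) (k : ℤ) :
    AbelianVariety.IsIsogeny (k • 𝟙 A + φ) :=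
  isIsogeny_of_comp_eq_zsmul_id (N := k ^ 2 + 7) (by positivity)
    (zsmul_id_add_comp_zsmul_id_sub hφ k) (zsmul_id_sub_comp_zsmul_id_add hφ k)

/-- **Pull-back along an isogeny `u : A ⟶ A` preserves algebraic classes**: isogenies are flat
(`IsIsogeny.flat`, Görtz–Wedhorn II, Prop. 27.54), abelian varieties are locally Noetherian
(smooth projective, `AbelianVariety.isSmoothProjective_holds`), and flat pull-back preserves
`algebraicClasses` (`map_mem_algebraicClasses_of_flat`). [cite: GortzWedhorn2023, Prop. 27.54] -/
theorem map_mem_algebraicClasses_of_isIsogeny {u : A ⟶ A} (hu : AbelianVariety.IsIsogeny u) {p : ℕ}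
    {c : complexBetti A.X (2 * p)} (hc : c ∈ algebraicClasses A.X p) :
    complexBetti.map u.hom.hom.hom (2 * p) c ∈ algebraicClasses A.X p := by
  haveI : IsLocallyNoetherian A.X.left :=
    IsSmoothProjective.isLocallyNoetherian_holds (n := A.dim)
      (AbelianVariety.isSmoothProjective_holds (A := A))
  haveI : Flat u.hom.hom.hom.left := hu.flat
  exact map_mem_algebraicClasses_of_flat u.hom.hom.hom hc

/-! ### The stub -/

/-- **Stub 2 — the switch on the real carriers (transfer of Stub 1 along `H⁸ = ⋀⁸H¹`).**  GIVEN the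
abstract switch (Stub 1's statement, hypothesis `hAbs`), the exterior-algebra structure of the
cohomology of complex abelian varieties with `dim H¹ = 2 dim A` (Stub 3's statement, `hExt`) and the
additivity of pull-back on `H¹` (Stub 4's statement, `hAdd`): for a complex abelian EIGHTFOLD `A` with
endomorphisms `φ ≫ φ = -7`, `ψ ≫ ψ = -3m²` (`m ≥ 1`), `φ ≫ ψ + ψ ≫ φ = t·𝟙`, `t² < 84m²`, if every
class of the typed `ψ`-plane `Eig((2m·𝟙+ψ)^*, m⁸(2+i√3)⁸) ⊔ Eig((2m·𝟙+ψ)^*, m⁸(2-i√3)⁸) ⊆ H⁸(A(ℂ); ℂ)`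
is algebraic then so is every class of the typed `φ`-plane `Eig((𝟙+φ)^*, (1±i√7)⁸)`.  PROOF: put
`V = H¹(A(ℂ); ℂ)` (`dim 16` by `hExt`), `F = φ^*|V`, `G = ψ^*|V`; `hAdd` + functoriality give
`F² = -7`, `G² = -3m²`, `FG + GF = t`, `(k·𝟙+φ)^*|V = k+F`, `(2m·𝟙+ψ)^*|V = 2m+G`; naturality
`u^* ∘ wedgeToCup = wedgeToCup ∘ ⋀⁸(u^*|V)` (`map_comp_wedgeToCup`) and bijectivity of `wedgeToCup`
(`hExt`) identify the typed planes on `H⁸` with the abstract ones and `(k·𝟙+φ)^*|H⁸` with `⋀⁸(k+F)`;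
Stub 1 puts the `φ`-plane inside `Σ_k (k·𝟙+φ)^*(ψ-plane)`; `k·𝟙+φ` is an isogeny
(`isIsogeny_zsmul_id_add`), so `(k·𝟙+φ)^*` preserves `algebraicClasses`
(`map_mem_algebraicClasses_of_isIsogeny`), a `ℂ`-submodule. [cite: vanGeemen1994HodgeAV, 3.6–3.7 and 4.8–4.9] -/
theorem stub_switchTransfer :
    (∀ (V : Type) [AddCommGroup V] [Module ℂ V] [FiniteDimensional ℂ V],
      Module.finrank ℂ V = 16 →
    ∀ (F G : V →ₗ[ℂ] V) (m : ℕ) (t : ℤ), 0 < m →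
      F ∘ₗ F = -((7 : ℂ) • LinearMap.id) →
      G ∘ₗ G = -((3 * (m : ℂ) ^ 2) • LinearMap.id) →
      F ∘ₗ G + G ∘ₗ F = (t : ℂ) • LinearMap.id →
      t ^ 2 < 84 * (m : ℤ) ^ 2 →
    ∀ x : ⋀[ℂ]^8 V,
      x ∈ Module.End.eigenspace (exteriorPower.map 8 (LinearMap.id + F))
            ((1 + Complex.I * (Real.sqrt (7 : ℝ) : ℂ)) ^ 8) ⊔
          Module.End.eigenspace (exteriorPower.map 8 (LinearMap.id + F))
            ((1 - Complex.I * (Real.sqrt (7 : ℝ) : ℂ)) ^ 8) →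
      x ∈ ⨆ k : Fin 9, Submodule.map (exteriorPower.map 8 (((k : ℕ) : ℂ) • LinearMap.id + F))
          (Module.End.eigenspace (exteriorPower.map 8 ((2 * (m : ℂ)) • LinearMap.id + G))
              ((m : ℂ) ^ 8 * (2 + Complex.I * (Real.sqrt (3 : ℝ) : ℂ)) ^ 8) ⊔
            Module.End.eigenspace (exteriorPower.map 8 ((2 * (m : ℂ)) • LinearMap.id + G))
              ((m : ℂ) ^ 8 * (2 - Complex.I * (Real.sqrt (3 : ℝ) : ℂ)) ^ 8))) →
    (∀ A : AbelianVariety ℂ,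
      HasExteriorCohomologyH1 ℂ (ComplexPoints A.X) ∧ Module.finrank ℂ (complexBetti A.X 1) = 2 * A.dim) →
    (∀ (A : AbelianVariety ℂ) (f g : A ⟶ A) (v : complexBetti A.X 1),
      complexBetti.map (f + g).hom.hom.hom 1 v =
        complexBetti.map f.hom.hom.hom 1 v + complexBetti.map g.hom.hom.hom 1 v) →
    ∀ (A : AbelianVariety ℂ) (φ ψ : A ⟶ A) (m : ℕ) (t : ℤ), A.dim = 8 → 0 < m →
      φ ≫ φ = -((7 : ℤ) • 𝟙 A) → ψ ≫ ψ = -((3 * (m : ℤ) ^ 2) • 𝟙 A) →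
      φ ≫ ψ + ψ ≫ φ = t • 𝟙 A → t ^ 2 < 84 * (m : ℤ) ^ 2 →
      (∀ c : complexBetti A.X 8,
        c ∈ Module.End.eigenspace (complexBetti.map ((2 * (m : ℤ)) • 𝟙 A + ψ).hom.hom.hom 8).hom
              ((m : ℂ) ^ 8 * (2 + Complex.I * (Real.sqrt (3 : ℝ) : ℂ)) ^ 8) ⊔
            Module.End.eigenspace (complexBetti.map ((2 * (m : ℤ)) • 𝟙 A + ψ).hom.hom.hom 8).hom
              ((m : ℂ) ^ 8 * (2 - Complex.I * (Real.sqrt (3 : ℝ) : ℂ)) ^ 8) →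
        c ∈ algebraicClasses A.X 4) →
      ∀ c : complexBetti A.X 8,
        c ∈ Module.End.eigenspace (complexBetti.map (𝟙 A + φ).hom.hom.hom 8).hom
              ((1 + Complex.I * (Real.sqrt (7 : ℝ) : ℂ)) ^ 8) ⊔
            Module.End.eigenspace (complexBetti.map (𝟙 A + φ).hom.hom.hom 8).hom
              ((1 - Complex.I * (Real.sqrt (7 : ℝ) : ℂ)) ^ 8) →
        c ∈ algebraicClasses A.X 4 := by
  intro hAbs hExt hAdd A φ ψ m t hA hm hφ hψ hφψ ht hψalg c hc
  have hAddA := hAdd A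
  obtain ⟨hE, hrank⟩ := hExt A
  have h16 : Module.finrank ℂ (complexBetti A.X 1) = 16 := by rw [hrank, hA]
  haveI : FiniteDimensional ℂ (complexBetti A.X 1) :=
    FiniteDimensional.of_finrank_pos (by rw [h16]; norm_num)
  -- the quaternionic relations on `V = H¹(A(ℂ); ℂ)` for `F = φ^*|_V`, `G = ψ^*|_V`
  have hF : (complexBetti.map φ.hom.hom.hom 1).hom ∘ₗ (complexBetti.map φ.hom.hom.hom 1).hom =
      -((7 : ℂ) • LinearMap.id) := by
    rw [← hom_map_comp, hφ, hom_map_one_neg hAddA, hom_map_one_zsmul_id hAddA]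
    norm_num
  have hG : (complexBetti.map ψ.hom.hom.hom 1).hom ∘ₗ (complexBetti.map ψ.hom.hom.hom 1).hom =
      -((3 * (m : ℂ) ^ 2) • LinearMap.id) := by
    rw [← hom_map_comp, hψ, hom_map_one_neg hAddA, hom_map_one_zsmul_id hAddA]
    push_cast
    rfl
  have hFG : (complexBetti.map φ.hom.hom.hom 1).hom ∘ₗ (complexBetti.map ψ.hom.hom.hom 1).hom +
      (complexBetti.map ψ.hom.hom.hom 1).hom ∘ₗ (complexBetti.map φ.hom.hom.hom 1).hom =
      (t : ℂ) • LinearMap.id := by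
    rw [← hom_map_comp, ← hom_map_comp, ← hom_map_one_add hAddA, hφψ, hom_map_one_zsmul_id hAddA]
  have h1φ : (complexBetti.map (𝟙 A + φ).hom.hom.hom 1).hom =
      LinearMap.id + (complexBetti.map φ.hom.hom.hom 1).hom := by
    rw [hom_map_one_add hAddA, hom_map_id]
  have hkφ : ∀ k : ℕ, (complexBetti.map (((k : ℕ) : ℤ) • 𝟙 A + φ).hom.hom.hom 1).hom =
      ((k : ℕ) : ℂ) • LinearMap.id + (complexBetti.map φ.hom.hom.hom 1).hom := fun k => by
    rw [hom_map_one_add hAddA, hom_map_one_zsmul_id hAddA, Int.cast_natCast]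
  have h2ψ : (complexBetti.map ((2 * (m : ℤ)) • 𝟙 A + ψ).hom.hom.hom 1).hom =
      (2 * (m : ℂ)) • LinearMap.id + (complexBetti.map ψ.hom.hom.hom 1).hom := by
    rw [hom_map_one_add hAddA, hom_map_one_zsmul_id hAddA]
    push_cast
    rfl
  -- the abstract switch (Stub 1) on `⋀⁸ H¹`
  have key := hAbs (complexBetti A.X 1) h16 (complexBetti.map φ.hom.hom.hom 1).hom
    (complexBetti.map ψ.hom.hom.hom 1).hom m t hm hF hG hFG ht
  -- the typed `φ`-plane of `H⁸` is `wedgeToCup` of the abstract `(1+F)`-plane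
  rw [← map_wedgeToCup_eigenspace hE 8 (𝟙 A + φ) h1φ, ← map_wedgeToCup_eigenspace hE 8 (𝟙 A + φ) h1φ,
    ← Submodule.map_sup] at hc
  obtain ⟨x, hx, rfl⟩ := Submodule.mem_map.1 hc
  -- Stub 1, then push each summand `⋀⁸(k+F) (abstract ψ-plane)` through `wedgeToCup`
  refine map_mem_of_mem_iSup (wedgeToCup ℂ (ComplexPoints A.X) 8) (key x hx) fun k => ?_
  rw [map_wedgeToCup_map 8 ((((k : Fin 9) : ℕ) : ℤ) • 𝟙 A + φ) (hkφ k), Submodule.map_sup,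
    map_wedgeToCup_eigenspace hE 8 ((2 * (m : ℤ)) • 𝟙 A + ψ) h2ψ,
    map_wedgeToCup_eigenspace hE 8 ((2 * (m : ℤ)) • 𝟙 A + ψ) h2ψ]
  -- `(k·𝟙 + φ)^*` of the (algebraic) typed `ψ`-plane is algebraic: `k·𝟙 + φ` is an isogeny
  refine Submodule.map_le_iff_le_comap.2 fun c' hc' => ?_
  rw [Submodule.mem_comap]
  exact map_mem_algebraicClasses_of_isIsogeny (p := 4) (isIsogeny_zsmul_id_add hφ _) (hψalg c' hc')

end Summit.HodgeConjecture.HodgeConjecture.Theorems.HyperbolicEightfoldsSqrtMinus7.DicyclicQuaternionSwitch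

end
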